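import Literature.NumberTheory.Transcendental.QuadraticRelationsLogarithmsPlaces
import Literature.NumberTheory.Transcendental.QuadraticRelationsLogarithmsSec4Heights
import Mathlib.RingTheory.Valuation.Discrete.Basic
import Mathlib.FieldTheory.IntermediateField.Adjoin.Algebra
import Mathlib.Algebra.Module.Rat
import HarnessLib

/-!
# Roy–Waldschmidt 1997, §§3–5: the two renderings of "places of `K` over `ℚ`" agree

D. Roy, M. Waldschmidt, *Approximation diophantienne et indépendance algébrique de logarithmes*,
Ann. Sci. ÉNS (4) 30 (1997) 753–796, §4, p. 772: "`K ⊂ ℂ` un sous-corps de `ℂ` de type fini et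
de degré de transcendance `1` sur `ℚ`, donc un corps de fonctions en une variable sur `ℚ` … une
place non triviale `𝔮` de `K` sur `ℚ` … `ord_𝔮`, `deg(𝔮)`, `𝐡`, `𝐡₁`".

The tree carries TWO renderings of this sentence, and this file PROVES that they are the same:

* `RoyWaldschmidt1997.Place K` (`…QuadraticRelationsLogarithmsPlaces.lean`, the vocabulary of the
  Théorème 5.1 assembly): a place is its normalised discrete valuation `v_𝔮 : K → ℤᵐ⁰`, trivial on
  `ℚ`, with `Place.ring`, `Place.ord`, `Place.deg`, `Place.IsReduction` and the affine height
  `ffHeight₁ : (ι → K) → ℕ`;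
* `AlgFunctionField.PlaceOver ℚ K` (the tree's library of algebraic function fields of one
  variable, `Literature.NumberTheory.DiophantineGeometry.FunctionField*`, after Stichtenoth): a
  place is its valuation ring (a DVR containing the constants), with `PlaceOver.ord`,
  `PlaceOver.degree`, divisors, the product formula `degree_principalDivisor_eq_zero`, finiteness
  of zeros and poles, Riemann–Roch …; the §4 brick of the paper — heights `projHeight`/`affHeight`
  of points and `subspaceHeight` of subspaces, reduction `V̄`, regular bases, **Lemmes 4.2–4.7**
  and the linear core `thm_4_1_linear_core` of **Théorème 4.1** — is proved over it in
  `…Sec4Heights.lean`, `…Sec4Regular.lean`, `…Sec4Subspaces.lean`, `…Sec4Projection.lean`,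
  `…Sec4Thm41Core.lean`.

PROVED here (no definitions of mathematical content beyond the two conversion maps, no named
facts):

* `isAlgFunctionField_of_fg` — `K.FG → trdeg_ℚ K = 1 → IsAlgFunctionField ℚ K` (the hypothesis
  of Théorème 5.1 in the form used by `…Sec6Final.lean` gives the library's class);
* `Place.toPlaceOver : Place K → PlaceOver ℚ K` (same valuation ring — `rfl` — which is a DVR by
  Serre, *Corps locaux* I §1 Prop. 1 = Mathlib's `Valuation.valuationSubring_isDiscreteValuationRing`)
  and `placeOfPlaceOver : PlaceOver ℚ K → Place K` (`v_𝔮(x) = exp(-ord_𝔮 x)`), inverse to each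
  other: **`placeEquiv : Place K ≃ PlaceOver ℚ K`**;
* the dictionaries `Place.ord_toPlaceOver` (`ord` agree), `Place.degree_toPlaceOver` (`deg` agree),
  `Place.val_eq_exp_neg_placeOver_ord`, `placeOfPlaceOver_ring`, `placeOfPlaceOver_ord`,
  `placeOfPlaceOver_deg`;
* **`natCast_ffHeight₁ : (ffHeight₁ x : ℤ) = affHeight ℚ x`** for `K` a function field (so every
  statement of the §4 brick about `h₁` is a statement about `ffHeight₁`), finiteness of the set of
  places contributing to `ffHeight₁`;
* **Lemme 4.2 in the `Place` vocabulary**: `Place.lemme_4_2` (`𝐡₁(x) < deg 𝔭 ⇒ x ∈ 𝒪_𝔭 ∧ x̄ ≠ 0`),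
  `Place.isReduction_ne_zero` (the same with a reduction map `τ`, `p.IsReduction τ`: `τ x ≠ 0`),
  `Place.mem_ring_and_inv_mem_ring` (`x, x⁻¹ ∈ 𝒪_𝔭`, §5 p. 781) and the tuple form
  `Place.forall_mem_ring_of_ffHeight₁_lt`;
* **reduction maps** `τ : 𝒪_𝔭 → ℂ` ("un plongement de son corps résiduel dans `ℂ`", Théorème 3.1
  p. 763, Théorème 4.1 p. 772): `Place.IsReduction.exists_lift` (`τ = ι ∘ (x ↦ x̄)`, `ι : K̃ ↪ ℂ`),
  `Place.isReduction_comp_residue` (converse), `Place.finiteDimensional_residueField` and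
  `Place.deg_pos` (`K̃/ℚ` finite, `deg 𝔭 ≥ 1`, Stichtenoth Prop. 1.1.15 via the library),
  **`Place.exists_isReduction`** (every place HAS a reduction map: `K̃` embeds in `ℂ`), and
  `Place.isReduction_mul_inv_eq_one` (`τ(x)τ(x⁻¹) = 1` under Lemme 4.2's hypothesis).

## References

* [RoyWaldschmidt1997ENS] D. Roy, M. Waldschmidt, Ann. Sci. ÉNS (4) 30 (1997) 753–796, §4
  pp. 772–773 (places, `ord_𝔮`, `deg 𝔮`, `𝐡₁`, Lemme 4.2), §5 p. 781.
* H. Stichtenoth, *Algebraic Function Fields and Codes*, GTM 254 (2009), §1.1 (Def. 1.1.8,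
  Thm. 1.1.6, Def. 1.1.12, Thm. 1.1.13): places as valuation rings / as discrete valuations.
* J.-P. Serre, *Corps locaux*, I §1 Prop. 1 (the valuation ring of a discrete valuation is a DVR).
-/

noncomputable section

open scoped WithZero

namespace Literature.NumberTheory.Transcendental

namespace RoyWaldschmidt1997

open Literature.NumberTheory.DiophantineGeometry
open Literature.NumberTheory.DiophantineGeometry.AlgFunctionField
open WithZero (exp log)

variable {K : IntermediateField ℚ ℂ}

/-! ### A finitely generated subfield of `ℂ` of transcendence degree one is a function field -/

/-- "`K` un sous-corps de `ℂ` de type fini et de degré de transcendance `1` sur `ℚ`, donc un corps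
de fonctions en une variable sur `ℚ`": the hypotheses of Théorème 5.1 give the library's class
`IsAlgFunctionField ℚ K`. [cite: RoyWaldschmidt1997ENS, §4, p. 772] -/
theorem isAlgFunctionField_of_fg (hfg : K.FG) (hK : Algebra.trdeg ℚ K = 1) :
    IsAlgFunctionField ℚ K :=
  ⟨hK, IntermediateField.fg_top_iff.mpr (IntermediateField.essFiniteType_iff.mpr hfg)⟩

/-! ### From `Place K` to `PlaceOver ℚ K` -/

namespace Place

/-- Two places with the same normalised valuation are equal. [folklore] -/
theorem ext_val {p q : Place K} (h : p.val = q.val) : p = q := by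
  cases p; cases q; cases h; rfl

/-- `v_𝔮(x) ≠ 0` for `x ≠ 0`. [folklore] -/
theorem val_ne_zero' (p : Place K) {x : K} (hx : x ≠ 0) : p.val x ≠ 0 :=
  (Valuation.ne_zero_iff _).mpr hx

/-- Units of `𝒪_𝔮` have valuation `1`: if `x ≠ 0` and `x, x⁻¹ ∈ 𝒪_𝔮` then `v_𝔮(x) = 1`.
[folklore] -/
theorem val_eq_one_of_mem_of_inv_mem (p : Place K) {x : K} (hx0 : x ≠ 0) (hx : x ∈ p.ring)
    (hx' : x⁻¹ ∈ p.ring) : p.val x = 1 := by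
  rw [mem_ring_iff] at hx hx'
  rw [map_inv₀, inv_le_one₀ (zero_lt_iff.mpr (p.val_ne_zero' hx0))] at hx'
  exact le_antisymm hx hx'

/-- `𝒪_𝔮 ≠ K`: the inverse of a uniformiser is not in `𝒪_𝔮`. [folklore] -/
theorem ring_ne_top (p : Place K) : p.ring ≠ ⊤ := by
  obtain ⟨π, hπ⟩ := p.exists_uniformizer
  intro h
  have hmem : π⁻¹ ∈ p.ring := h ▸ ValuationSubring.mem_top _
  rw [mem_ring_iff, map_inv₀, hπ, ← WithZero.exp_neg, neg_neg, ← WithZero.exp_zero,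
    WithZero.exp_le_exp] at hmem
  exact absurd hmem (by norm_num)

/-- The value group of `v_𝔮` is non-trivial (it contains `v_𝔮(π) = exp(-1) ≠ 1`). [folklore] -/
theorem nontrivial_valueGroup (p : Place K) :
    Nontrivial (MonoidWithZeroHom.valueGroup (MonoidWithZeroHom.ofClass p.val)) := by
  obtain ⟨π, hπ⟩ := p.exists_uniformizer
  have hne0 : p.val π ≠ 0 := by rw [hπ]; exact WithZero.exp_ne_zero
  have hne1 : p.val π ≠ 1 := by
    rw [hπ, ← WithZero.exp_zero, Ne, WithZero.exp_inj]
    decide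
  refine ⟨⟨⟨Units.mk0 _ hne0, MonoidWithZeroHom.mem_valueGroup _ ⟨π, rfl⟩⟩, 1, fun h => hne1 ?_⟩⟩
  simpa using congrArg
    (fun g : MonoidWithZeroHom.valueGroup (MonoidWithZeroHom.ofClass p.val) =>
      ((g : (ℤᵐ⁰)ˣ) : ℤᵐ⁰)) h

/-- **`𝒪_𝔮` is a discrete valuation ring** (the valuation ring of a discrete valuation of rank
one: Serre, *Corps locaux* I §1 Prop. 1, Mathlib's
`Valuation.valuationSubring_isDiscreteValuationRing`). [folklore] -/
theorem isDiscreteValuationRing_ring (p : Place K) : IsDiscreteValuationRing p.ring := by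
  haveI := p.nontrivial_valueGroup
  exact Valuation.valuationSubring_isDiscreteValuationRing p.val

/-- **The place of the function field `K/ℚ` (library sense) defined by `𝔮`**: its valuation ring
`𝒪_𝔮`, a proper sub-DVR of `K` containing `ℚ`. [cite: RoyWaldschmidt1997ENS, §4, p. 772] -/
def toPlaceOver (p : Place K) : PlaceOver ℚ K where
  toValuationSubring := p.ring
  ne_top := p.ring_ne_top
  isDVR := p.isDiscreteValuationRing_ring
  algebraMap_mem c := by
    rw [eq_ratCast]
    exact p.ratCast_mem_ring c

/-- The valuation ring of `p.toPlaceOver` is `𝒪_𝔮` (by construction). [folklore] -/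
@[simp]
theorem toPlaceOver_toValuationSubring (p : Place K) : p.toPlaceOver.toValuationSubring = p.ring :=
  rfl

/-- A non-zero non-unit of `𝒪_𝔮` has valuation `exp(-j)` with `j ≥ 1`; in particular the
library's uniformiser `π_𝔮` of the DVR `𝒪_𝔮` has `v_𝔮(π_𝔮) < 1`. [folklore] -/
theorem log_val_uniformizer_le (p : Place K) :
    log (p.val (p.toPlaceOver.uniformizer : K)) ≤ -1 := by
  set π := (p.toPlaceOver.uniformizer : K) with hπdef
  have hπ0 : π ≠ 0 := p.toPlaceOver.coe_uniformizer_ne_zero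
  have hv0 : p.val π ≠ 0 := p.val_ne_zero' hπ0
  have hle : p.val π ≤ 1 := (p.mem_ring_iff π).1 (p.toPlaceOver.uniformizer).2
  have hne : p.val π ≠ 1 := by
    intro h1
    -- `v(π) = 1` would make `π` a unit of `𝒪_𝔮`
    have hu : IsUnit (p.toPlaceOver.uniformizer) :=
      (Valuation.valuationSubring.integers p.val).isUnit_of_one' h1
    exact p.toPlaceOver.irreducible_uniformizer.not_isUnit hu
  have hlt : p.val π < 1 := lt_of_le_of_ne hle hne
  have h := (WithZero.log_lt_log hv0 one_ne_zero).2 hlt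
  rw [WithZero.log_one] at h
  omega

/-- **The library's uniformiser of `𝒪_𝔮` has valuation `exp(-1)`** (all uniformisers of a DVR
are associated; the place is normalised: some element has valuation `exp(-1)`). [folklore] -/
theorem val_uniformizer (p : Place K) :
    p.val (p.toPlaceOver.uniformizer : K) = exp (-1 : ℤ) := by
  obtain ⟨π₀, hπ₀⟩ := p.exists_uniformizer
  have hπ₀0 : π₀ ≠ 0 := by
    intro h
    rw [h, map_zero] at hπ₀
    exact WithZero.exp_ne_zero hπ₀.symm
  have hπ₀mem : π₀ ∈ p.ring := by
    rw [mem_ring_iff, hπ₀, ← WithZero.exp_zero, WithZero.exp_le_exp]; norm_num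
  have ha : (⟨π₀, hπ₀mem⟩ : p.toPlaceOver.toValuationSubring) ≠ 0 := fun h =>
    hπ₀0 (congrArg Subtype.val h)
  obtain ⟨m, u, hu⟩ :=
    IsDiscreteValuationRing.eq_unit_mul_pow_irreducible ha p.toPlaceOver.irreducible_uniformizer
  -- read `π₀ = u π^m` in `K` and apply `v_𝔮`
  have hK : π₀ = ((u : p.toPlaceOver.toValuationSubring) : K) *
      (p.toPlaceOver.uniformizer : K) ^ m := by
    have := congrArg (fun z : p.toPlaceOver.toValuationSubring => (z : K)) hu
    simp only [MulMemClass.coe_mul, SubmonoidClass.coe_pow] at this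
    exact this
  have hval_u : p.val ((u : p.toPlaceOver.toValuationSubring) : K) = 1 :=
    (Valuation.valuationSubring.integers p.val).one_of_isUnit u.isUnit
  have hv0 : p.val (p.toPlaceOver.uniformizer : K) ≠ 0 :=
    p.val_ne_zero' p.toPlaceOver.coe_uniformizer_ne_zero
  have hmain : exp (-1 : ℤ) = p.val (p.toPlaceOver.uniformizer : K) ^ m := by
    rw [← hπ₀, hK, map_mul, map_pow, hval_u, one_mul]
  -- take logarithms: `-1 = m • log v(π)` with `log v(π) ≤ -1`
  have hlog : (-1 : ℤ) = m • log (p.val (p.toPlaceOver.uniformizer : K)) := by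
    have := congrArg log hmain
    rwa [WithZero.log_exp, WithZero.log_pow] at this
  have hl := p.log_val_uniformizer_le
  set l := log (p.val (p.toPlaceOver.uniformizer : K)) with hldef
  have hm1 : (m : ℤ) * (-l) = 1 := by
    rw [nsmul_eq_mul] at hlog
    linear_combination hlog
  have hm : (m : ℤ) = 1 := Int.eq_one_of_mul_eq_one_right (by positivity) hm1
  have hl1 : l = -1 := by rw [hm, one_mul] at hm1; omega
  rw [← WithZero.exp_log hv0, ← hldef, hl1]

/-- **`v_𝔮(x) = exp(-ord_𝔮 x)` with the LIBRARY's order** `PlaceOver.ord` of the place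
`p.toPlaceOver` (`x ≠ 0`): the normalised valuation of the place is determined by its valuation
ring (Stichtenoth Thm. 1.1.6/1.1.13: `x = u π_𝔮^{ord x}`). [folklore] -/
theorem val_eq_exp_neg_placeOver_ord (p : Place K) {x : K} (hx : x ≠ 0) :
    p.val x = exp (-(p.toPlaceOver.ord x)) := by
  -- in the value group of `𝒪_𝔮`: `w(x) = w(π^n)`, `n = ord x`
  have hw : p.toPlaceOver.valuation x =
      p.toPlaceOver.valuation ((p.toPlaceOver.uniformizer : K) ^ p.toPlaceOver.ord x) := by
    rw [map_zpow₀]; exact p.toPlaceOver.valuation_eq_zpow_ord hx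
  -- `p.val` and `w = 𝒪_𝔮.valuation` are equivalent valuations (same valuation ring)
  have hequiv : p.val.IsEquiv p.toPlaceOver.valuation :=
    Valuation.isEquiv_valuation_valuationSubring p.val
  have h1 : p.val x ≤ p.val ((p.toPlaceOver.uniformizer : K) ^ p.toPlaceOver.ord x) :=
    (hequiv x _).2 hw.le
  have h2 : p.val ((p.toPlaceOver.uniformizer : K) ^ p.toPlaceOver.ord x) ≤ p.val x :=
    (hequiv _ x).2 hw.ge
  rw [le_antisymm h1 h2, map_zpow₀, p.val_uniformizer, ← WithZero.exp_zsmul, zsmul_eq_mul,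
    Int.cast_id, mul_neg, mul_one]

/-- **The two orders agree**: `ord_𝔮 = PlaceOver.ord (p.toPlaceOver)` (both have the junk value
`0` at `x = 0`). [cite: RoyWaldschmidt1997ENS, §4, p. 772] -/
theorem ord_toPlaceOver (p : Place K) (x : K) : p.toPlaceOver.ord x = p.ord x := by
  by_cases hx : x = 0
  · rw [hx, ord_zero_eq, Place.ord, map_zero, WithZero.log_zero, neg_zero]
  · rw [Place.ord, p.val_eq_exp_neg_placeOver_ord hx, WithZero.log_exp, neg_neg]

/-- **The two degrees agree**: `deg(𝔮) = [K̃ : ℚ] = PlaceOver.degree (p.toPlaceOver)` (same residue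
field; the two `ℚ`-module structures on it coincide, `ℚ`-module structures being unique).
[cite: RoyWaldschmidt1997ENS, §4, p. 772] -/
theorem degree_toPlaceOver (p : Place K) : p.toPlaceOver.degree = p.deg := by
  unfold PlaceOver.degree Place.deg PlaceOver.residueField
  congr 1
  exact Subsingleton.elim _ _

/-- Membership in `𝒪_𝔮` versus the library order: for `x ≠ 0`, `x ∈ 𝒪_𝔮 ↔ 0 ≤ ord x`. [folklore] -/
theorem mem_ring_iff_placeOver_ord_nonneg (p : Place K) {x : K} (hx : x ≠ 0) :
    x ∈ p.ring ↔ 0 ≤ p.toPlaceOver.ord x :=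
  p.toPlaceOver.mem_toValuationSubring_iff_ord_nonneg hx

end Place

/-! ### From `PlaceOver ℚ K` to `Place K` -/

/-- The normalised `ℤᵐ⁰`-valued valuation `x ↦ exp(-ord_v x)` (`0 ↦ 0`) of a place `v` of the
function field `K/ℚ` in the library sense (Stichtenoth Def. 1.1.12 / Thm. 1.1.13: `ord_v` is a
discrete valuation). [folklore] -/
def valOfPlaceOver (v : PlaceOver ℚ K) : Valuation K ℤᵐ⁰ where
  toFun x := if x = 0 then 0 else exp (-v.ord x)
  map_zero' := by simp
  map_one' := by simp [PlaceOver.ord_one]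
  map_mul' x y := by
    by_cases hx : x = 0
    · simp [hx]
    by_cases hy : y = 0
    · simp [hy]
    simp only [mul_eq_zero, hx, hy, or_self, if_false, v.ord_mul_eq hx hy, neg_add,
      WithZero.exp_add]
  map_add_le_max' x y := by
    by_cases hx : x = 0
    · simp [hx]
    by_cases hy : y = 0
    · simp [hy]
    by_cases hxy : x + y = 0
    · simp [hxy]
    have h := PlaceOver.min_ord_le_ord_add_holds v hx hy hxy
    simp only [hx, hy, hxy, if_false, le_max_iff, WithZero.exp_le_exp, neg_le_neg_iff]
    exact min_le_iff.1 h

/-- Unfolding `valOfPlaceOver` off zero. [folklore] -/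
theorem valOfPlaceOver_apply (v : PlaceOver ℚ K) {x : K} (hx : x ≠ 0) :
    valOfPlaceOver v x = exp (-v.ord x) := by
  simp [valOfPlaceOver, hx]

/-- `valOfPlaceOver v 0 = 0`. [folklore] -/
theorem valOfPlaceOver_zero (v : PlaceOver ℚ K) : valOfPlaceOver v 0 = 0 := map_zero _

/-- **The place `𝔮` (normalised-valuation sense) of a place `v` of `K/ℚ` (valuation-ring sense)**:
`v_𝔮 = exp(-ord_v)`, uniformiser `π_v` (`ord_v π_v = 1`), trivial on `ℚ^×` (constants have
order `0`). [cite: RoyWaldschmidt1997ENS, §4, p. 772] -/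
def placeOfPlaceOver (v : PlaceOver ℚ K) : Place K where
  val := valOfPlaceOver v
  exists_uniformizer := ⟨v.uniformizer, by
    rw [valOfPlaceOver_apply v v.coe_uniformizer_ne_zero, v.ord_uniformizer_eq_one]⟩
  val_ratCast q hq := by
    have hq' : (q : K) ≠ 0 := by exact_mod_cast hq
    rw [valOfPlaceOver_apply v hq', ← WithZero.exp_zero, WithZero.exp_inj, neg_eq_zero]
    have h := PlaceOver.ord_algebraMap_holds v (c := q) hq
    rwa [eq_ratCast] at h

/-- The valuation of `placeOfPlaceOver v` is `valOfPlaceOver v`. [folklore] -/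
@[simp]
theorem placeOfPlaceOver_val (v : PlaceOver ℚ K) : (placeOfPlaceOver v).val = valOfPlaceOver v :=
  rfl

/-- **`ord` is preserved**: `(placeOfPlaceOver v).ord = ord_v`. [cite: RoyWaldschmidt1997ENS, §4, p. 772] -/
theorem placeOfPlaceOver_ord (v : PlaceOver ℚ K) (x : K) : (placeOfPlaceOver v).ord x = v.ord x := by
  by_cases hx : x = 0
  · rw [hx, ord_zero_eq, Place.ord, map_zero, WithZero.log_zero, neg_zero]
  · rw [Place.ord, placeOfPlaceOver_val, valOfPlaceOver_apply v hx, WithZero.log_exp, neg_neg]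

/-- **The valuation ring is preserved**: `𝒪_{placeOfPlaceOver v} = O_v`. [folklore] -/
theorem placeOfPlaceOver_ring (v : PlaceOver ℚ K) :
    (placeOfPlaceOver v).ring = v.toValuationSubring := by
  ext x
  by_cases hx : x = 0
  · simp [hx, zero_mem]
  rw [Place.mem_ring_iff, placeOfPlaceOver_val, valOfPlaceOver_apply v hx,
    v.mem_toValuationSubring_iff_ord_nonneg hx, ← WithZero.exp_zero, WithZero.exp_le_exp]
  omega

/-- Round trip: `(placeOfPlaceOver v).toPlaceOver = v`. [folklore] -/
@[simp]
theorem toPlaceOver_placeOfPlaceOver (v : PlaceOver ℚ K) : (placeOfPlaceOver v).toPlaceOver = v :=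
  PlaceOver.ext (placeOfPlaceOver_ring v)

/-- Round trip: `placeOfPlaceOver p.toPlaceOver = p` (a place is determined by its valuation
ring together with the normalisation). [folklore] -/
@[simp]
theorem placeOfPlaceOver_toPlaceOver (p : Place K) : placeOfPlaceOver p.toPlaceOver = p := by
  refine Place.ext_val (Valuation.ext fun x => ?_)
  by_cases hx : x = 0
  · simp [hx]
  rw [placeOfPlaceOver_val, valOfPlaceOver_apply _ hx, p.val_eq_exp_neg_placeOver_ord hx]

/-- **The two renderings of "place of `K` over `ℚ`" are equivalent**: normalised discrete
valuations of `K` trivial on `ℚ` (`RoyWaldschmidt1997.Place K`) ↔ proper sub-DVRs of `K`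
containing `ℚ` (`AlgFunctionField.PlaceOver ℚ K`, Stichtenoth Def. 1.1.8), compatibly with
`ord`, `deg` and valuation rings (`Place.ord_toPlaceOver`, `Place.degree_toPlaceOver`,
`Place.toPlaceOver_toValuationSubring`, `placeOfPlaceOver_ord`, `placeOfPlaceOver_ring`).
[cite: RoyWaldschmidt1997ENS, §4, p. 772] -/
def placeEquiv : Place K ≃ PlaceOver ℚ K where
  toFun := Place.toPlaceOver
  invFun := placeOfPlaceOver
  left_inv := placeOfPlaceOver_toPlaceOver
  right_inv := toPlaceOver_placeOfPlaceOver

/-- `placeEquiv p = p.toPlaceOver`. [folklore] -/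
@[simp]
theorem placeEquiv_apply (p : Place K) : placeEquiv p = p.toPlaceOver := rfl

/-- `placeEquiv.symm v = placeOfPlaceOver v`. [folklore] -/
@[simp]
theorem placeEquiv_symm_apply (v : PlaceOver ℚ K) : placeEquiv.symm v = placeOfPlaceOver v := rfl

/-- **`deg` is preserved**: `(placeOfPlaceOver v).deg = deg v`. [cite: RoyWaldschmidt1997ENS, §4, p. 772] -/
theorem placeOfPlaceOver_deg (v : PlaceOver ℚ K) : (placeOfPlaceOver v).deg = v.degree := by
  rw [← Place.degree_toPlaceOver, toPlaceOver_placeOfPlaceOver]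

/-! ### The two affine heights agree -/

variable {ι : Type*} [Fintype ι]

/-- The local term of `ffHeight₁` at a place, read in the library: for a tuple `x` and a place `v`,
`max_i max{0, -ord_v(x_i)} = max{0, -ord_v(x)}` where `ord_v(x) = min ord_v(x_i)` over the non-zero
coordinates (`ordVec`). [cite: RoyWaldschmidt1997ENS, §4, p. 772] -/
theorem natCast_sup_toNat_neg_ord (v : PlaceOver ℚ K) (x : ι → K) :
    ((Finset.univ.sup fun i => (-(v.ord (x i))).toNat : ℕ) : ℤ) = max 0 (-ordVec v x) := by
  classical
  set M : ℤ := max 0 (-ordVec v x) with hM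
  have hM0 : 0 ≤ M := le_max_left _ _
  -- every local term is `≤ M`
  have hle : ∀ i, -(v.ord (x i)) ≤ M := by
    intro i
    by_cases hi : x i = 0
    · rw [hi, ord_zero_eq, neg_zero]; exact hM0
    · exact (neg_le_neg (ordVec_le v hi)).trans (le_max_right _ _)
  apply le_antisymm
  · have h1 : (Finset.univ.sup fun i => (-(v.ord (x i))).toNat) ≤ M.toNat :=
      Finset.sup_le fun i _ => Int.toNat_le_toNat (hle i)
    calc ((Finset.univ.sup fun i => (-(v.ord (x i))).toNat : ℕ) : ℤ) ≤ (M.toNat : ℤ) := by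
          exact_mod_cast h1
      _ = M := Int.toNat_of_nonneg hM0
  · refine max_le (by positivity) ?_
    by_cases hx : x = 0
    · simp [hx]
    obtain ⟨i, hi, hiq⟩ := exists_ordVec_eq v hx
    rw [hiq]
    calc -(v.ord (x i)) ≤ ((-(v.ord (x i))).toNat : ℤ) := Int.self_le_toNat _
      _ ≤ ((Finset.univ.sup fun i => (-(v.ord (x i))).toNat : ℕ) : ℤ) := by
          exact_mod_cast Finset.le_sup (f := fun i => (-(v.ord (x i))).toNat) (Finset.mem_univ i)

/-- The local term of `ffHeight₁` at the place `placeOfPlaceOver v`, as an integer: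
`deg v · max{0, -ord_v(x)}`. [cite: RoyWaldschmidt1997ENS, §4, p. 772] -/
theorem natCast_ffHeight₁_term (v : PlaceOver ℚ K) (x : ι → K) :
    (((placeOfPlaceOver v).deg * Finset.univ.sup fun i => (-((placeOfPlaceOver v).ord (x i))).toNat
      : ℕ) : ℤ) = max 0 (-ordVec v x) * (v.degree : ℤ) := by
  simp only [placeOfPlaceOver_ord, placeOfPlaceOver_deg]
  push_cast
  rw [natCast_sup_toNat_neg_ord v x, mul_comm]

/-- A place contributes to `ffHeight₁ x` only if it is a pole of some coordinate, i.e. only if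
`ord_v(x) ≠ 0` for the corresponding library place. [folklore] -/
theorem ordVec_ne_zero_of_ffHeight₁_term_ne_zero (v : PlaceOver ℚ K) (x : ι → K)
    (h : ((placeOfPlaceOver v).deg * Finset.univ.sup fun i =>
      (-((placeOfPlaceOver v).ord (x i))).toNat) ≠ 0) : ordVec v x ≠ 0 := by
  intro h0
  have h' := natCast_ffHeight₁_term v x
  rw [h0, neg_zero, max_self, zero_mul] at h'
  exact h (by exact_mod_cast h')

/-- **Only finitely many places contribute to `ffHeight₁ x`** when `K` is a function field of one
variable over `ℚ` (finiteness of poles, Stichtenoth Cor. 1.3.4). [cite: RoyWaldschmidt1997ENS, §4, p. 772] -/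
theorem finite_support_ffHeight₁_term [IsAlgFunctionField ℚ K] (x : ι → K) :
    (Function.support fun q : Place K =>
      q.deg * Finset.univ.sup fun i => (-(q.ord (x i))).toNat).Finite := by
  have hfin := finite_setOf_ordVec_ne_zero (k := ℚ) x
  refine (hfin.preimage (placeEquiv (K := K)).injective.injOn).subset ?_
  intro q hq
  rw [Function.mem_support] at hq
  simp only [Set.mem_preimage, Set.mem_setOf_eq]
  refine ordVec_ne_zero_of_ffHeight₁_term_ne_zero (placeEquiv q) x ?_
  simpa only [placeEquiv_apply, placeOfPlaceOver_toPlaceOver] using hq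

/-- **The two affine heights agree: `𝐡₁ = h₁`.**  For `K` finitely generated of transcendence
degree one over `ℚ`, the height `ffHeight₁ x = ∑_𝔮 deg(𝔮) max{0, -ord_𝔮(xᵢ)}` of the Théorème 5.1
vocabulary is the affine height `affHeight ℚ x = ∑_v max{0, -ord_v(x)} deg v` of the §4 brick
(`…Sec4Heights.lean`), place by place along `placeEquiv`.  Consequently every estimate of
`…Sec4Heights.lean` … `…Sec4Thm41Core.lean` about `h₁` applies verbatim to `𝐡₁`.
[cite: RoyWaldschmidt1997ENS, §4, p. 772] -/
theorem natCast_ffHeight₁ [IsAlgFunctionField ℚ K] (x : ι → K) :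
    (ffHeight₁ x : ℤ) = affHeight ℚ x := by
  classical
  -- the local term as a function of the place
  set F : Place K → ℕ := fun q => q.deg * Finset.univ.sup fun i => (-(q.ord (x i))).toNat with hF
  have hff : ffHeight₁ x = ∑ᶠ q : Place K, F q := rfl
  -- reindex along `placeEquiv.symm : PlaceOver ℚ K ≃ Place K`
  have hre : ∑ᶠ q : Place K, F q = ∑ᶠ v : PlaceOver ℚ K, F (placeOfPlaceOver v) :=
    (finsum_comp_equiv (placeEquiv (K := K)).symm (f := F)).symm
  -- a finite set of places carrying both sums
  obtain ⟨T, hT, -⟩ := exists_finset_places (k := ℚ) {x} (∅ : Finset K)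
  have hTx : ∀ v : PlaceOver ℚ K, ordVec v x ≠ 0 → v ∈ T := hT x (by simp)
  have hsum : ∑ᶠ v : PlaceOver ℚ K, F (placeOfPlaceOver v) = ∑ v ∈ T, F (placeOfPlaceOver v) := by
    apply finsum_eq_sum_of_support_subset
    intro v hv
    rw [Function.mem_support] at hv
    exact Finset.mem_coe.2 (hTx v (ordVec_ne_zero_of_ffHeight₁_term_ne_zero v x hv))
  rw [hff, hre, hsum, affHeight_eq_sum x T hTx, Nat.cast_sum]
  exact Finset.sum_congr rfl fun v _ => natCast_ffHeight₁_term v x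

/-- `ffHeight₁ x` as the natural-number value of `affHeight ℚ x`. [cite: RoyWaldschmidt1997ENS, §4, p. 772] -/
theorem ffHeight₁_eq_toNat_affHeight [IsAlgFunctionField ℚ K] (x : ι → K) :
    ffHeight₁ x = (affHeight ℚ x).toNat := by
  rw [← natCast_ffHeight₁ x, Int.toNat_natCast]

/-- `affHeight` does not see the indexing of a constant tuple: `h₁(x, …, x) = h₁(x)` — used to
pass between `ffHeight₁ (fun _ : Unit => x)` and `affHeight ℚ ![x]`. [folklore] -/
theorem affHeight_const_eq [IsAlgFunctionField ℚ K] [Nonempty ι] (x : K) :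
    affHeight ℚ (fun _ : ι => x) = affHeight ℚ ![x] := by
  apply le_antisymm
  · have h := affHeight_comp_le (k := ℚ) ![x] (fun _ : ι => (0 : Fin 1))
    exact h
  · obtain ⟨i⟩ := ‹Nonempty ι›
    have h := affHeight_comp_le (k := ℚ) (fun _ : ι => x) (fun _ : Fin 1 => i)
    have e : ((fun _ : ι => x) ∘ fun _ : Fin 1 => i) = ![x] := by
      funext j; fin_cases j; rfl
    rw [e] at h
    exact h

/-- `𝐡₁(x) = h₁(x)` for a single element. [cite: RoyWaldschmidt1997ENS, §4, p. 773] -/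
theorem natCast_ffHeight₁_single [IsAlgFunctionField ℚ K] (x : K) :
    (ffHeight₁ (fun _ : Unit => x) : ℤ) = affHeight ℚ ![x] := by
  rw [natCast_ffHeight₁, affHeight_const_eq]

/-! ### Lemme 4.2 in the vocabulary of `Place` -/

namespace Place

/-- **Roy–Waldschmidt, Lemme 4.2** in the `Place` vocabulary: "Soit `x` un élément non nul de `K`.
Si `𝐡₁(x) < D`, alors on a `x ∈ 𝒪` et `x̄ ≠ 0`" (`𝔭` a place of degree `D = deg 𝔭`, `𝒪 = 𝒪_𝔭`,
`x̄` the reduction of `x` in the residue field) — transported from `RoyWaldschmidt1997.lemme_4_2`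
along `placeEquiv`. [cite: RoyWaldschmidt1997ENS, Lemme 4.2, p. 773] -/
theorem lemme_4_2 [IsAlgFunctionField ℚ K] (p : Place K) {x : K} (hx : x ≠ 0)
    (h : ffHeight₁ (fun _ : Unit => x) < p.deg) :
    ∃ hmem : x ∈ p.ring, IsLocalRing.residue p.ring ⟨x, hmem⟩ ≠ 0 := by
  have h' : affHeight ℚ ![x] < p.toPlaceOver.degree := by
    rw [degree_toPlaceOver, ← natCast_ffHeight₁_single]
    exact_mod_cast h
  exact RoyWaldschmidt1997.lemme_4_2 p.toPlaceOver hx h'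

/-- Lemme 4.2 with "un plongement de son corps résiduel dans `ℂ`": for a reduction map
`τ : 𝒪_𝔭 → ℂ` (`p.IsReduction τ`), `𝐡₁(x) < deg 𝔭` and `x ≠ 0` give `x ∈ 𝒪_𝔭` and `τ(x) ≠ 0`.
[cite: RoyWaldschmidt1997ENS, Lemme 4.2, p. 773 and Théorème 3.1, p. 763] -/
theorem isReduction_ne_zero [IsAlgFunctionField ℚ K] (p : Place K) {τ : p.ring →+* ℂ}
    (hτ : p.IsReduction τ) {x : K} (hx : x ≠ 0) (h : ffHeight₁ (fun _ : Unit => x) < p.deg) :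
    ∃ hmem : x ∈ p.ring, τ ⟨x, hmem⟩ ≠ 0 := by
  obtain ⟨hmem, hres⟩ := p.lemme_4_2 hx h
  refine ⟨hmem, fun h0 => hres ?_⟩
  rw [IsLocalRing.residue_eq_zero_iff, ← hτ, RingHom.mem_ker]
  exact h0

/-- Lemme 4.2 for `x` and `x⁻¹` ("non seulement les points … mais aussi leurs inverses ont leurs
coordonnées dans `𝒪`", §5 p. 781): `𝐡₁(x) < deg 𝔭`, `x ≠ 0` ⇒ `x, x⁻¹ ∈ 𝒪_𝔭`.
[cite: RoyWaldschmidt1997ENS, Lemme 4.2, p. 773 and §5, p. 781] -/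
theorem mem_ring_and_inv_mem_ring [IsAlgFunctionField ℚ K] (p : Place K) {x : K} (hx : x ≠ 0)
    (h : ffHeight₁ (fun _ : Unit => x) < p.deg) : x ∈ p.ring ∧ x⁻¹ ∈ p.ring := by
  have h' : affHeight ℚ ![x] < p.toPlaceOver.degree := by
    rw [degree_toPlaceOver, ← natCast_ffHeight₁_single]
    exact_mod_cast h
  exact mem_and_inv_mem_of_affHeight_lt_degree p.toPlaceOver hx h'

/-- `ord_𝔭(x) = 0` when `𝐡₁(x) < deg 𝔭` and `x ≠ 0` (valuation form of Lemme 4.2).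
[cite: RoyWaldschmidt1997ENS, Lemme 4.2, p. 773] -/
theorem ord_eq_zero_of_ffHeight₁_lt [IsAlgFunctionField ℚ K] (p : Place K) {x : K} (hx : x ≠ 0)
    (h : ffHeight₁ (fun _ : Unit => x) < p.deg) : p.ord x = 0 := by
  have h' : affHeight ℚ ![x] < p.toPlaceOver.degree := by
    rw [degree_toPlaceOver, ← natCast_ffHeight₁_single]
    exact_mod_cast h
  rw [← ord_toPlaceOver]
  exact ord_eq_zero_of_affHeight_lt_degree p.toPlaceOver hx h'

/-- Tuple form of Lemme 4.2: if `𝐡₁(x₁, …, xₙ) < deg 𝔭` then every `xᵢ` lies in `𝒪_𝔭`.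
[cite: RoyWaldschmidt1997ENS, Lemme 4.2, p. 773] -/
theorem forall_mem_ring_of_ffHeight₁_lt [IsAlgFunctionField ℚ K] (p : Place K) {x : ι → K}
    (h : ffHeight₁ x < p.deg) (i : ι) : x i ∈ p.ring := by
  have h' : affHeight ℚ x < p.toPlaceOver.degree := by
    rw [degree_toPlaceOver, ← natCast_ffHeight₁]
    exact_mod_cast h
  exact forall_mem_of_affHeight_lt_degree p.toPlaceOver h' i

end Place

/-! ### Reduction maps `τ : 𝒪_𝔭 → ℂ` ("un plongement de son corps résiduel dans `ℂ`") -/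

namespace Place

/-- For a reduction map `τ` of the place (`p.IsReduction τ`: `ker τ = 𝔪_𝔭`): `τ x = 0 ↔ x ∈ 𝔪_𝔭`.
[cite: RoyWaldschmidt1997ENS, Théorème 3.1, p. 763] -/
theorem IsReduction.map_eq_zero_iff {p : Place K} {τ : p.ring →+* ℂ} (hτ : p.IsReduction τ)
    (x : p.ring) : τ x = 0 ↔ x ∈ IsLocalRing.maximalIdeal p.ring := by
  rw [← RingHom.mem_ker]
  unfold IsReduction at hτ
  rw [hτ]

/-- A reduction map is a local homomorphism (units of `𝒪_𝔭` do not reduce to `0`). [folklore] -/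
theorem IsReduction.isLocalHom {p : Place K} {τ : p.ring →+* ℂ} (hτ : p.IsReduction τ) :
    IsLocalHom τ := by
  refine ⟨fun x hx => ?_⟩
  by_contra hnu
  have hmem : x ∈ IsLocalRing.maximalIdeal p.ring := (IsLocalRing.mem_maximalIdeal _).2 hnu
  exact hx.ne_zero ((hτ.map_eq_zero_iff x).2 hmem)

/-- `x̄ = 0` in the residue field iff `τ x = 0`. [cite: RoyWaldschmidt1997ENS, §4, p. 773] -/
theorem IsReduction.residue_eq_zero_iff {p : Place K} {τ : p.ring →+* ℂ} (hτ : p.IsReduction τ)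
    (x : p.ring) : IsLocalRing.residue p.ring x = 0 ↔ τ x = 0 := by
  rw [IsLocalRing.residue_eq_zero_iff, hτ.map_eq_zero_iff]

/-- **A reduction map IS an embedding of the residue field composed with the reduction
`𝒪_𝔭 → K̃`**: `τ = ι ∘ (x ↦ x̄)` with `ι : K̃ →+* ℂ` injective. [cite: RoyWaldschmidt1997ENS, Théorème 3.1, p. 763 and §4, p. 773] -/
theorem IsReduction.exists_lift {p : Place K} {τ : p.ring →+* ℂ} (hτ : p.IsReduction τ) :
    ∃ ι : IsLocalRing.ResidueField p.ring →+* ℂ,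
      Function.Injective ι ∧ ∀ x, ι (IsLocalRing.residue p.ring x) = τ x := by
  haveI := hτ.isLocalHom
  exact ⟨IsLocalRing.ResidueField.lift τ, (IsLocalRing.ResidueField.lift τ).injective,
    fun x => IsLocalRing.ResidueField.lift_residue_apply τ x⟩

/-- Conversely an embedding `ι : K̃ →+* ℂ` of the residue field gives the reduction map
`ι ∘ (x ↦ x̄)`. [cite: RoyWaldschmidt1997ENS, Théorème 3.1, p. 763] -/
theorem isReduction_comp_residue (p : Place K) (ι : IsLocalRing.ResidueField p.ring →+* ℂ) :
    p.IsReduction (ι.comp (IsLocalRing.residue p.ring)) := by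
  unfold IsReduction
  rw [← RingHom.comap_ker, (RingHom.injective_iff_ker_eq_bot _).1 ι.injective,
    ← RingHom.ker_eq_comap_bot]
  exact IsLocalRing.ker_residue

/-- `deg 𝔭 ≥ 1` (Stichtenoth Prop. 1.1.15 via the library and `toPlaceOver`).
[cite: RoyWaldschmidt1997ENS, §4, p. 772] -/
theorem deg_pos [IsAlgFunctionField ℚ K] (p : Place K) : 0 < p.deg := by
  rw [← degree_toPlaceOver]
  haveI : FiniteDimensional ℚ p.toPlaceOver.residueField :=
    PlaceOver.finiteDimensional_residueField_holds (K := ℚ) (F := K) p.toPlaceOver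
  exact Module.finrank_pos

/-- **The residue field `K̃` of a place of the function field `K/ℚ` is a finite extension of
`ℚ`** (Stichtenoth Prop. 1.1.15). [cite: RoyWaldschmidt1997ENS, §4, p. 772] -/
theorem finiteDimensional_residueField [IsAlgFunctionField ℚ K] (p : Place K) :
    FiniteDimensional ℚ (IsLocalRing.ResidueField p.ring) :=
  Module.finite_of_finrank_pos p.deg_pos

/-- **"On choisit un plongement de son corps résiduel dans `ℂ`"**: every place of `K/ℚ` admits a
reduction map `τ : 𝒪_𝔭 → ℂ` with kernel `𝔪_𝔭` (the residue field, a number field, embeds in the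
algebraically closed field `ℂ`). [cite: RoyWaldschmidt1997ENS, Théorème 3.1, p. 763 and Théorème 4.1, p. 772] -/
theorem exists_isReduction [IsAlgFunctionField ℚ K] (p : Place K) :
    ∃ τ : p.ring →+* ℂ, p.IsReduction τ := by
  haveI := p.finiteDimensional_residueField
  let ι : IsLocalRing.ResidueField p.ring →ₐ[ℚ] ℂ := IsAlgClosed.lift
  exact ⟨ι.toRingHom.comp (IsLocalRing.residue p.ring), p.isReduction_comp_residue ι.toRingHom⟩

/-- With a reduction map the conclusion of Lemme 4.2 reads: `x ∈ 𝒪_𝔭`, `x⁻¹ ∈ 𝒪_𝔭` and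
`τ(x) τ(x⁻¹) = 1` — "aucune de ces coordonnées ne s'annule sous `r`" (§5 p. 781).
[cite: RoyWaldschmidt1997ENS, Lemme 4.2, p. 773 and §5, p. 781] -/
theorem isReduction_mul_inv_eq_one [IsAlgFunctionField ℚ K] (p : Place K) {τ : p.ring →+* ℂ}
    {x : K} (hx : x ≠ 0) (h : ffHeight₁ (fun _ : Unit => x) < p.deg) :
    ∃ (hmem : x ∈ p.ring) (hmem' : x⁻¹ ∈ p.ring), τ ⟨x, hmem⟩ * τ ⟨x⁻¹, hmem'⟩ = 1 := by
  obtain ⟨hmem, hmem'⟩ := p.mem_ring_and_inv_mem_ring hx h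
  refine ⟨hmem, hmem', ?_⟩
  rw [← map_mul, ← map_one τ]
  congr 1
  exact Subtype.ext (mul_inv_cancel₀ hx)

end Place

end RoyWaldschmidt1997

end Literature.NumberTheory.Transcendental
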